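import Literature.Probability.LatticeModels.BoundarySurgeryCoupling
import Literature.Probability.LatticeModels.SquareRingGeometry
import HarnessLib

/-!
# [MOS94] Proposition 2.1: under weak mixing a boundary perturbation of a square in `ℤ²` does not propagate
# along the boundary — PROVED

Topic `Literature/Probability/LatticeModels`; cell `ym-ir`, seat lit-3 (census row B2 «weak mixing ⇒ strong
mixing in two dimensions»).  THEOREMS ONLY (D-0026).  F. Martinelli, E. Olivieri, R. H. Schonmann, *For 2-D
lattice spin systems weak mixing implies strong mixing*, Commun. Math. Phys. 165 (1994) 33–47
[cite: MartinelliOlivieriSchonmann1994, Proposition 2.1]: for a finite-range (`r`), translation-invariant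
interaction with finite single-spin space on `ℤ²` whose Gibbs measures satisfy `WM(Λ, C, γ)` for all finite
`Λ`, there are `C₀, γ₀ > 0` such that for every square `Λ_L`, every site `y ∉ Λ_L` and all boundary
conditions `τ, τ′` that agree off `y`, the marginals of `μ_{Λ_L}^τ` and `μ_{Λ_L}^{τ′}` on
`Q_{L,y} = {x ∈ Λ_L : ‖x − y‖ ≥ L^{1/2}}` are within `C₀ e^{−γ₀ L^{1/4}}` in variation (p0006 L1–6, (2.3),
(2.12)); and consequence (2.1) for arbitrary `τ, τ′` by the triangle inequality along the boundary.

Assembly of `BoundarySurgeryCoupling.lean` (the surgery coupling along scales, [MOS94] (2.4)–(2.12)) and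
`SquareRingGeometry.lean` (the rings around `y`, facts (a), (b) and «at most one bad scale»):
* `abs_sub_le_pow_square` — the estimate at fixed `L`, `y` and explicit scales `R_i = R₀ + i s`: under
  `WM` on the far regions `Γ(R_i)` and the numerical smallness of the weak-mixing sum (fact (a)),
  `|μ^τ(E) − μ^{τ′}(E)| ≤ (1 − δ)^{n−2}` for events `E` of the spins in `Γ(R_n)`, `δ = ε(8 r l₀)/2`;
* `MOS1994_prop2_1` — the printed statement with the choice `s = q = ⌊L^{1/4}⌋`, `m = (q−1)/2`, `n = q − 1`
  rings of radii `r + iq ≤ √L` ([MOS94]: `l_i ↗ L^{1/2}` in steps `L^{1/4}`, margin `L^{1/4}/2`), the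
  threshold in `q` coming from `x^k e^{−x} → 0`; bound `C₀ exp(−γ₀ ⌊⌊√L⌋^{1/2}⌋)` and the `L^{1/4}` form
  `MOS1994_prop2_1_rpow`;
* `MOS1994_eq2_1` — (2.1): for arbitrary `τ, τ′` and events of the spins at distance `≥ ⌊√L⌋` from every
  disagreement site of `τ, τ′` in `∂_r^+Λ_L`,
  `|μ^τ(E) − μ^{τ′}(E)| ≤ C₀ · #{z ∈ ∂_r^+Λ_L : τ z ≠ τ′ z} · e^{−γ₀ L^{1/4}}` (one application of
  Proposition 2.1 per disagreement site and the triangle inequality); `MOS1994_eq2_1_innerSquare` — the same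
  for events of the inner square `Λ_{L−⌊√L⌋}` with prefactor `|∂_r^+Λ_L| ≤ (2(L+r)+1)² − (2L+1)²`
  (`card_rOuterBoundary_centeredCube_le`): the quantity of [MOS94] Thm 2.1 (2.2) = [MO1] (4.2).
What is NOT here: [MOS94] Theorem 1.1 itself (`MOS1994_weakMixing_imp_strongMixing` of
`StrongMixingFiniteSize.lean`) combines Proposition 2.1 with [MO1] = Martinelli–Olivieri, CMP 161 (1994)
447–486, Thm 4.1 / Prop 4.1 (a finite-size condition on ONE square ⇒ strong mixing on all squares, via
block Glauber dynamics), which is not held (acq-03742) and not formalised; the named fact stays undischarged.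
SIBLING-SETTING result (classical lattice spins); the Yang–Mills mass gap (Clay) is NOT touched (R4 closes
only the conditional finite-𝕋⁴ rung `BalabanLadder.UV`).
-/

open MeasureTheory Finset Filter

noncomputable section

namespace Literature.Probability.LatticeModels

namespace WeakMixingSurgery

open BoundarySurgery SquareRing DisagreementCoupling

universe v

variable {S : Type v} [MeasurableSpace S] [MeasurableSingletonClass S] [Fintype S] [Nonempty S]
  [DecidableEq S] {r : ℕ}

open scoped Classical

omit [MeasurableSpace S] [MeasurableSingletonClass S] [Fintype S] [Nonempty S] [DecidableEq S] in
/-- Dependence on a set of coordinates is inherited by supersets. [folklore] -/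
private theorem dependsOn_mono {f : (Site 2 → S) → Prop} {s t : Set (Site 2)} (h : DependsOn f s) (hst : s ⊆ t) :
    DependsOn f t :=
  fun _ _ hxy => h fun i hi => hxy i (hst hi)

omit [DecidableEq S] in
/-- A difference of two probabilities is at most one in absolute value. [folklore] -/
private theorem abs_real_sub_real_le_one (U : FRPotential 2 S r) (β : ℝ) (Λ : Finset (Site 2))
    (τ τ' : Site 2 → S) (E : Set (Site 2 → S)) :
    |(U.spec β Λ τ).real E - (U.spec β Λ τ').real E| ≤ 1 := by
  have hγ := U.isSpecification_spec β
  haveI := hγ.isProbability Λ τ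
  haveI := hγ.isProbability Λ τ'
  rw [abs_sub_le_iff]
  constructor <;> linarith [measureReal_nonneg (μ := U.spec β Λ τ) (s := E),
    measureReal_nonneg (μ := U.spec β Λ τ') (s := E),
    measureReal_le_one (μ := U.spec β Λ τ) (s := E), measureReal_le_one (μ := U.spec β Λ τ') (s := E)]
set_option maxHeartbeats 400000 in
/-- **[MOS94] Proposition 2.1 at fixed scales.**  Square `Λ_L`, boundary site `y ∉ Λ_L` with `|y_j| ≤ L + r`,
boundary conditions `τ, τ′` equal off `y`, radii `R_i = R₀ + i s` (`i = 1, …, n`) with `r ≤ s`, `r ≤ R₀`,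
`l₀ + r ≤ m`, `2m < s`, `m + r < R₀ + s`, `R_n + m < L`; weak mixing `WM(Γ(R_i), C, γ)` on the far regions
and the numerical smallness of fact (a)'s bound.  Then every event `E` of the spins in `Γ(R_n)` has
`|μ_{Λ_L}^τ(E) − μ_{Λ_L}^{τ′}(E)| ≤ (1 − δ)^{n−2}`, `δ = ε(8 r l₀)/2` (`ε` the atom bound of
`BoundarySurgeryCoupling`). [cite: MartinelliOlivieriSchonmann1994, Proposition 2.1 (proof, (2.12))] -/
theorem abs_sub_le_pow_square (U : FRPotential 2 S r) (β : ℝ) {C γ : ℝ} (hC : 0 ≤ C) (hγ : 0 < γ)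
    {Cu : ℝ} (hCu0 : 0 ≤ Cu) (hCu : ∀ (X : Finset (Site 2)) (σ : Site 2 → S), |U.U X σ| ≤ Cu)
    {L : ℕ} {y : Site 2} (hy : y ∉ centeredCube 2 L) (hyr : ∀ j, (y j).natAbs ≤ L + r)
    {τ τ' : Site 2 → S} (hττ' : ∀ z, z ≠ y → τ z = τ' z)
    {l₀ m s R₀ n : ℕ} (hrs : r ≤ s) (hR₀ : r ≤ R₀) (hml : l₀ + r ≤ m) (h2m : 2 * m < s)
    (hmR : m + r < R₀ + s) (hRL : R₀ + n * s + m < L)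
    (hWM : ∀ i, 1 ≤ i → i < n → WeakMixing (U.spec β) r (far L (R₀ + i * s) y) C γ)
    (hnum : C * ((((2 * (R₀ + n * s) + 1) ^ 2 : ℕ) : ℝ) * (((2 * (R₀ + n * s) + 1) ^ 2 : ℕ) : ℝ) *
        Real.exp (-(γ * ((s - r : ℕ) : ℝ))) +
      Kconst γ * ((((2 * (R₀ + n * s) + 1) ^ 2 : ℕ) : ℝ) * Real.exp (-(γ / 2 * ((m + 1 - r : ℕ) : ℝ))) +
        16 * r * Real.exp (-(γ / 2 * ((l₀ : ℝ) + 1))) * (1 - Real.exp (-(γ / 2)))⁻¹)) ≤ 1 / 2)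
    {E : Set (Site 2 → S)} (hE : MeasurableSet E)
    (hdep : DependsOn (· ∈ E) (↑(far L (R₀ + n * s) y) : Set (Site 2))) :
    |(U.spec β (centeredCube 2 L) τ).real E - (U.spec β (centeredCube 2 L) τ').real E| ≤
      (1 - atomLB β Cu r 2 (Fintype.card S) (8 * r * l₀) / 2) ^ (n - 2) := by
  set Λ := centeredCube 2 L with hΛ
  set δ := atomLB β Cu r 2 (Fintype.card S) (8 * r * l₀) / 2 with hδ
  have hε0 := atomLB_pos β Cu r 2 (Fintype.card_pos (α := S)) (8 * r * l₀)
  have hε1 := atomLB_le_one β hCu0 r 2 (Fintype.card_pos (α := S)) (8 * r * l₀)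
  have hδ0 : 0 ≤ δ := by rw [hδ]; linarith
  have hδ1 : δ ≤ 1 := by rw [hδ]; linarith
  -- trivial case `n = 0`
  rcases Nat.eq_zero_or_pos n with hn0 | hn
  · subst hn0
    simp only [Nat.zero_sub, pow_zero]
    exact abs_real_sub_real_le_one U β Λ τ τ' E
  -- the scheme
  set Rf : ℕ → ℕ := fun i => R₀ + i * s with hRf
  have hRf_succ : ∀ i, Rf (i + 1) = Rf i + s := fun i => by simp only [hRf]; ring
  have hRf_mono : ∀ i j, i ≤ j → Rf i ≤ Rf j := fun i j h => by
    simp only [hRf]; exact Nat.add_le_add_left (Nat.mul_le_mul_right _ h) _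
  have hRf_ge : ∀ i, r ≤ Rf i := fun i => by simp only [hRf]; omega
  set Γs : ℕ → Finset (Site 2) := fun i => far L (Rf i) y with hΓs
  set Ds : ℕ → Finset (Site 2) := fun i => ring L (Rf i) r y with hDs
  set good : ℕ → Prop := fun i => i < n ∧ GoodRadius L m (Rf (i + 1)) y with hgood_def
  have hmain := abs_sub_le_pow_of_scheme U β Λ τ τ' Γs Ds (n := n) hn
    (fun i _ _ => far_subset)
    (fun i _ _ => by
      show ring L (Rf (i + 1)) r y ⊆ far L (Rf i) y
      rw [hRf_succ]; exact ring_subset_far (by omega))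
    (fun i _ _ x hx hxΛ => mem_ring_of_mem_rOuterBoundary_far hx hxΛ)
    (fun i _ _ x hx hxΛ => hττ' x fun hxy => by
      subst hxy; exact not_mem_rOuterBoundary_far (hRf_ge i) hx)
    hδ0 hδ1 good ?_ hE hdep
  · -- count the good steps: all but at most one of `1, …, n−1`
    refine hmain.trans (pow_le_pow_of_le_one (by linarith) (by linarith) ?_)
    have hbad : ((Finset.Icc 1 (n - 1)).filter fun i => ¬ good i).card ≤ 1 := by
      have h1 := card_filter_not_goodRadius_le_one (L := L) (m := m) (R₀ := R₀) (s := s) (n := n) (y := y)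
        h2m hRL
      refine le_trans (Finset.card_le_card_of_injOn (fun i => i + 1) (fun i hi => ?_) ?_) h1
      · obtain ⟨hi, hgi⟩ := Finset.mem_filter.1 (Finset.mem_coe.1 hi)
        rw [Finset.mem_Icc] at hi
        have hi1 : 1 ≤ i := hi.1
        have hi2 : i ≤ n - 1 := hi.2
        have hin : i < n := by omega
        have hin1 : i + 1 ≤ n := by omega
        refine Finset.mem_coe.2 (Finset.mem_filter.2 ⟨Finset.mem_Icc.2 ⟨Nat.succ_pos i, hin1⟩,
          fun hg => hgi ⟨hin, ?_⟩⟩)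
        simpa only [hRf] using hg
      · intro i _ j _ h
        exact Nat.succ_injective h
    have htot := Finset.card_filter_add_card_filter_not (s := Finset.Icc 1 (n - 1)) good
    rw [Nat.card_Icc] at htot
    have hge : n - 2 ≤ ((Finset.Icc 1 (n - 1)).filter good).card := by omega
    convert hge
  · -- the good steps: weak mixing on `B(R_{i+1}) ⊆ Γ(R_i)` and finite energy on `A(R_{i+1})`
    intro i hi1 hin hg p _
    obtain ⟨hin', hgood⟩ := hg
    set R := Rf i with hR
    set R' := Rf (i + 1) with hR'
    have hRR' : R + r ≤ R' := by rw [hR', hRf_succ]; omega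
    have hR'n : R' ≤ R₀ + n * s := hRf_mono (i + 1) n (by omega)
    have hR'L : R' ≤ L := by omega
    have hmR' : m + r < R' := by
      have : Rf 1 ≤ R' := hRf_mono 1 (i + 1) (by omega)
      simp only [hRf, one_mul] at this
      omega
    have hrm : r ≤ m := by omega
    -- the three sets
    have hMΓ : ring L R' r y ⊆ far L R y := ring_subset_far hRR'
    have hBM : ringFar L R' r l₀ y ⊆ ring L R' r y := ringFar_subset_ring
    have ha : (ring L R' r y \ ringFar L R' r l₀ y).card ≤ 8 * r * l₀ := by
      rw [← ringNear_eq_sdiff]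
      exact card_ringNear_le hy hyr hgood hmR' hR'L hml
    have h1 := sum_min_qM_ge U β (Λ := Λ) hBM hMΓ hCu0 hCu ha τ τ' p.1 p.2
    -- the total variation on `B` is at most `1/2` by weak mixing and fact (a)
    obtain ⟨E', hE'm, hE'd, htv⟩ := tvd_qM_eq U β (Λ := Λ) (hBM.trans hMΓ) τ τ' p.1 p.2
    have hwm := hWM i hi1 hin' (ringFar L R' r l₀ y) (hBM.trans hMΓ) (glueWith Λ p.1 τ) (glueWith Λ p.2 τ')
      E' hE'm hE'd
    have hsum := wmSum_le (l₀ := l₀) hγ hy hyr hRR' hgood hrm hmR' hR'L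
    have hsr : R' - R - r = s - r := by
      rw [hR', hR, hRf_succ]; omega
    rw [hsr] at hsum
    have hmono : ((((2 * R' + 1) ^ 2 : ℕ) : ℝ) * (((2 * R + 1) ^ 2 : ℕ) : ℝ) * Real.exp (-(γ * ((s - r : ℕ) : ℝ))) +
        Kconst γ * ((((2 * R' + 1) ^ 2 : ℕ) : ℝ) * Real.exp (-(γ / 2 * ((m + 1 - r : ℕ) : ℝ))) +
          16 * r * Real.exp (-(γ / 2 * ((l₀ : ℝ) + 1))) * (1 - Real.exp (-(γ / 2)))⁻¹)) ≤
        (((2 * (R₀ + n * s) + 1) ^ 2 : ℕ) : ℝ) * (((2 * (R₀ + n * s) + 1) ^ 2 : ℕ) : ℝ) *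
          Real.exp (-(γ * ((s - r : ℕ) : ℝ))) +
        Kconst γ * ((((2 * (R₀ + n * s) + 1) ^ 2 : ℕ) : ℝ) * Real.exp (-(γ / 2 * ((m + 1 - r : ℕ) : ℝ))) +
          16 * r * Real.exp (-(γ / 2 * ((l₀ : ℝ) + 1))) * (1 - Real.exp (-(γ / 2)))⁻¹) := by
      have hRn : R ≤ R₀ + n * s := (hRf_mono i (i + 1) (by omega)).trans hR'n
      have e1 : (((2 * R' + 1) ^ 2 : ℕ) : ℝ) ≤ (((2 * (R₀ + n * s) + 1) ^ 2 : ℕ) : ℝ) := by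
        exact_mod_cast Nat.pow_le_pow_left (by omega) 2
      have e2 : (((2 * R + 1) ^ 2 : ℕ) : ℝ) ≤ (((2 * (R₀ + n * s) + 1) ^ 2 : ℕ) : ℝ) := by
        exact_mod_cast Nat.pow_le_pow_left (by omega) 2
      have hK := Kconst_nonneg γ
      have hx1 := (Real.exp_pos (-(γ * ((s - r : ℕ) : ℝ)))).le
      have hx2 := (Real.exp_pos (-(γ / 2 * ((m + 1 - r : ℕ) : ℝ)))).le
      gcongr
    have htv2 : tvd (qM U β τ (far L R y) (ringFar L R' r l₀ y) p.1)
        (qM U β τ' (far L R y) (ringFar L R' r l₀ y) p.2) ≤ 1 / 2 := by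
      rw [htv]
      refine (le_abs_self _).trans (hwm.trans ?_)
      refine (mul_le_mul_of_nonneg_left (hsum.trans hmono) hC).trans hnum
    -- conclude
    have : δ ≤ atomLB β Cu r 2 (Fintype.card S) (8 * r * l₀) *
        (1 - tvd (qM U β τ (far L R y) (ringFar L R' r l₀ y) p.1)
          (qM U β τ' (far L R y) (ringFar L R' r l₀ y) p.2)) := by
      rw [hδ]
      nlinarith
    exact this.trans h1

/-! ### The choice of scales and the printed statement -/

omit [MeasurableSpace S] [MeasurableSingletonClass S] [Fintype S] [Nonempty S] [DecidableEq S] in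
/-- `A q^k e^{−cq} ≤ ε` for all large natural `q` (from `x^k e^{−x} → 0`). [folklore] -/
private theorem exists_nat_pow_mul_exp_le (A : ℝ) {c ε : ℝ} (hc : 0 < c) (hε : 0 < ε) (k : ℕ) :
    ∃ N : ℕ, ∀ q : ℕ, N ≤ q → A * (q : ℝ) ^ k * Real.exp (-(c * q)) ≤ ε := by
  have h1 : Tendsto (fun x : ℝ => x ^ k * Real.exp (-x)) atTop (nhds 0) :=
    Real.tendsto_pow_mul_exp_neg_atTop_nhds_zero k
  have h2 : Tendsto (fun q : ℕ => c * (q : ℝ)) atTop atTop :=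
    (tendsto_natCast_atTop_atTop).const_mul_atTop hc
  have h3 := (h1.comp h2).const_mul (A / c ^ k)
  rw [mul_zero] at h3
  have h4 : ∀ q : ℕ, A / c ^ k * ((fun x : ℝ => x ^ k * Real.exp (-x)) ∘ fun q : ℕ => c * (q : ℝ)) q =
      A * (q : ℝ) ^ k * Real.exp (-(c * q)) := by
    intro q
    simp only [Function.comp, mul_pow]
    field_simp
  obtain ⟨N, hN⟩ := Filter.eventually_atTop.1 (h3.eventually (Iic_mem_nhds hε))
  exact ⟨N, fun q hq => by rw [← h4 q]; exact hN q hq⟩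

omit [DecidableEq S] in
/-- If `y` is farther than `r` from the square, changing the boundary condition at `y` does not change
`μ_{Λ_L}` on `Λ_L`-local events (finite range). [cite: MartinelliOlivieriSchonmann1994, §1 (1.3)] -/
theorem spec_real_eq_of_far (U : FRPotential 2 S r) (β : ℝ) {L : ℕ} {y : Site 2}
    (hfar : ¬ ∀ j, (y j).natAbs ≤ L + r) {τ τ' : Site 2 → S} (hττ' : ∀ z, z ≠ y → τ z = τ' z)
    {E : Set (Site 2 → S)} (hE : MeasurableSet E) (hdep : DependsOn (· ∈ E) (↑(centeredCube 2 L) : Set (Site 2))) :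
    (U.spec β (centeredCube 2 L) τ).real E = (U.spec β (centeredCube 2 L) τ').real E := by
  refine U.spec_real_eq_of_agree β (centeredCube 2 L) hE hdep (fun x hx hx' => absurd (Finset.mem_coe.1 hx) hx')
    fun x hx => hττ' x fun hxy => ?_
  subst hxy
  obtain ⟨_, z, hz, hxz⟩ := mem_rOuterBoundary.1 hx
  rw [mem_centeredCube] at hz
  refine hfar fun j => ?_
  have h1 := natAbs_sub_le_supDist x z j
  have h2 := hz j
  omega

omit [MeasurableSpace S] [MeasurableSingletonClass S] [Fintype S] [Nonempty S] [DecidableEq S] in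
/-- `r + p(p+1) + ⌊p/2⌋ < (p+1)⁴` for `r ≤ p`: the outermost ring fits in the square. [folklore] -/
private theorem nat_scales_lt (r p : ℕ) (hrp : r ≤ p) : r + p * (p + 1) + p / 2 < (p + 1) ^ 4 := by
  have hp2 : p / 2 ≤ p := Nat.div_le_self p 2
  calc r + p * (p + 1) + p / 2 ≤ p + p * (p + 1) + p := by omega
    _ < p + p * (p + 1) + p + (p ^ 4 + 4 * p ^ 3 + 5 * p ^ 2 + p + 1) :=
        Nat.lt_add_of_pos_right (by positivity)
    _ = (p + 1) ^ 4 := by ring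

omit [MeasurableSpace S] [MeasurableSingletonClass S] [Fintype S] [Nonempty S] [DecidableEq S] in
/-- `(2(r + p(p+1)) + 1)² ≤ ((2r+3)(p+1)²)²`. [folklore] -/
private theorem nat_radius_sq_le (r p : ℕ) :
    (2 * (r + p * (p + 1)) + 1) ^ 2 ≤ ((2 * r + 3) * (p + 1) ^ 2) ^ 2 := by
  refine Nat.pow_le_pow_left ?_ 2
  calc 2 * (r + p * (p + 1)) + 1
      ≤ 2 * (r + p * (p + 1)) + 1 + (r * (2 * p ^ 2 + 4 * p) + (p ^ 2 + 4 * p + 2)) := Nat.le_add_right _ _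
    _ = (2 * r + 3) * (p + 1) ^ 2 := by ring

omit [MeasurableSpace S] [MeasurableSingletonClass S] [Fintype S] [Nonempty S] [DecidableEq S] in
/-- The numerical smallness of fact (a)'s bound at the scales `s = q`, `m = (q−1)/2`, `R₀ = r`, `n = q − 1`,
for `q` beyond the thresholds. [cite: MartinelliOlivieriSchonmann1994, Proposition 2.1 (proof, fact (a))] -/
private theorem numeric_smallness {C γ : ℝ} (hC : 0 ≤ C) (hγ : 0 < γ) {r l₀ q N₁ N₂ : ℕ}
    (hl₀ : C * Kconst γ * (16 * r * Real.exp (-(γ / 2 * ((l₀ : ℝ) + 1))) * (1 - Real.exp (-(γ / 2)))⁻¹) ≤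
      1 / 6)
    (hN₁ : ∀ q : ℕ, N₁ ≤ q →
      C * (2 * r + 3) ^ 4 * Real.exp (γ * r) * (q : ℝ) ^ 8 * Real.exp (-(γ * q)) ≤ 1 / 6)
    (hN₂ : ∀ q : ℕ, N₂ ≤ q →
      C * Kconst γ * (2 * r + 3) ^ 2 * Real.exp (γ / 2 * r) * (q : ℝ) ^ 4 * Real.exp (-(γ / 4 * q)) ≤ 1 / 6)
    (hqN₁ : N₁ ≤ q) (hqN₂ : N₂ ≤ q) (hqr : r + 1 ≤ q) (hrm : r ≤ (q - 1) / 2) (hq3 : 3 ≤ q) :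
    C * ((((2 * (r + (q - 1) * q) + 1) ^ 2 : ℕ) : ℝ) * (((2 * (r + (q - 1) * q) + 1) ^ 2 : ℕ) : ℝ) *
        Real.exp (-(γ * ((q - r : ℕ) : ℝ))) +
      Kconst γ * ((((2 * (r + (q - 1) * q) + 1) ^ 2 : ℕ) : ℝ) *
          Real.exp (-(γ / 2 * (((q - 1) / 2 + 1 - r : ℕ) : ℝ))) +
        16 * r * Real.exp (-(γ / 2 * ((l₀ : ℝ) + 1))) * (1 - Real.exp (-(γ / 2)))⁻¹)) ≤ 1 / 2 := by
  obtain ⟨p, hp⟩ : ∃ p, q = p + 1 := ⟨q - 1, by omega⟩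
  have hn : q - 1 = p := by omega
  rw [hn] at hrm ⊢
  have hK : 0 ≤ Kconst γ := Kconst_nonneg γ
  -- casts of truncated subtractions
  have hs : ((q - r : ℕ) : ℝ) = (q : ℝ) - r := by rw [Nat.cast_sub (by omega)]
  have hmr : ((p / 2 + 1 - r : ℕ) : ℝ) = ((p / 2 : ℕ) : ℝ) + 1 - r := by
    rw [Nat.cast_sub (by omega)]; push_cast; ring
  have hm_real : ((q : ℝ) - 2) / 2 ≤ ((p / 2 : ℕ) : ℝ) := by
    have h0 : q - 2 ≤ 2 * (p / 2) := by omega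
    have h' : ((q - 2 : ℕ) : ℝ) ≤ ((2 * (p / 2) : ℕ) : ℝ) := by exact_mod_cast h0
    rw [Nat.cast_sub (by omega)] at h'
    push_cast at h'
    linarith
  -- `(2 R_n + 1)² ≤ (2r+3)² q⁴`
  have hZle : (((2 * (r + p * q) + 1) ^ 2 : ℕ) : ℝ) ≤ (2 * r + 3) ^ 2 * (q : ℝ) ^ 4 := by
    have h := nat_radius_sq_le r p
    rw [← hp] at h
    have h' : (((2 * (r + p * q) + 1) ^ 2 : ℕ) : ℝ) ≤ ((((2 * r + 3) * q ^ 2) ^ 2 : ℕ) : ℝ) := by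
      exact_mod_cast h
    refine h'.trans_eq ?_
    push_cast
    ring
  set Z : ℝ := (((2 * (r + p * q) + 1) ^ 2 : ℕ) : ℝ) with hZ
  have hZ0 : 0 ≤ Z := Nat.cast_nonneg _
  set W : ℝ := (2 * r + 3) ^ 2 * (q : ℝ) ^ 4 with hW
  have hW0 : 0 ≤ W := by positivity
  set e1 : ℝ := Real.exp (-(γ * ((q - r : ℕ) : ℝ))) with he1
  set e2 : ℝ := Real.exp (-(γ / 2 * ((p / 2 + 1 - r : ℕ) : ℝ))) with he2
  set X3 : ℝ := 16 * r * Real.exp (-(γ / 2 * ((l₀ : ℝ) + 1))) * (1 - Real.exp (-(γ / 2)))⁻¹ with hX3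
  -- term I: `C (2R_n+1)⁴ e^{−γ(q−r)} ≤ [C (2r+3)⁴ e^{γ r}] q⁸ e^{−γ q} ≤ 1/6`
  have hT1 : C * (Z * Z * e1) ≤ 1 / 6 := by
    have h := hN₁ q hqN₁
    have hexp : e1 = Real.exp (γ * r) * Real.exp (-(γ * q)) := by
      rw [he1, hs, ← Real.exp_add]; congr 1; ring
    have hle : Z * Z * e1 ≤ W * W * e1 :=
      mul_le_mul_of_nonneg_right (mul_le_mul hZle hZle hZ0 hW0) (Real.exp_pos _).le
    calc C * (Z * Z * e1) ≤ C * (W * W * e1) := mul_le_mul_of_nonneg_left hle hC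
      _ = C * (2 * r + 3) ^ 4 * Real.exp (γ * r) * (q : ℝ) ^ 8 * Real.exp (-(γ * q)) := by
          rw [hexp, hW]; ring
      _ ≤ 1 / 6 := h
  -- term II: `C K (2R_n+1)² e^{−(γ/2)(m+1−r)} ≤ [C K (2r+3)² e^{γ r/2}] q⁴ e^{−γ q/4} ≤ 1/6`
  have hT2 : C * Kconst γ * (Z * e2) ≤ 1 / 6 := by
    have h := hN₂ q hqN₂
    have hexp : e2 ≤ Real.exp (γ / 2 * r) * Real.exp (-(γ / 4 * q)) := by
      rw [he2, hmr, ← Real.exp_add, Real.exp_le_exp]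
      have := mul_le_mul_of_nonneg_left hm_real (half_pos hγ).le
      linarith
    have hle : Z * e2 ≤ W * (Real.exp (γ / 2 * r) * Real.exp (-(γ / 4 * q))) :=
      mul_le_mul hZle hexp (Real.exp_pos _).le hW0
    calc C * Kconst γ * (Z * e2) ≤ C * Kconst γ * (W * (Real.exp (γ / 2 * r) * Real.exp (-(γ / 4 * q)))) :=
          mul_le_mul_of_nonneg_left hle (mul_nonneg hC hK)
      _ = C * Kconst γ * (2 * r + 3) ^ 2 * Real.exp (γ / 2 * r) * (q : ℝ) ^ 4 *
            Real.exp (-(γ / 4 * q)) := by rw [hW]; ring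
      _ ≤ 1 / 6 := h
  -- together with term III (`hl₀`)
  have hexpand : C * (Z * Z * e1 + Kconst γ * (Z * e2 + X3)) =
      C * (Z * Z * e1) + C * Kconst γ * (Z * e2) + C * Kconst γ * X3 := by ring
  rw [hexpand]
  linarith

omit [MeasurableSpace S] [MeasurableSingletonClass S] [Fintype S] [Nonempty S] [DecidableEq S] in
/-- `(1 − δ)^{q−3} ≤ e^{δ(Q+3)} e^{−δ q}`. [folklore] -/
private theorem pow_le_exp_mul_exp {δ : ℝ} (hδ0 : 0 ≤ δ) (hδ1 : δ ≤ 1) (q Q : ℕ) (hq3 : 3 ≤ q) :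
    (1 - δ) ^ (q - 3) ≤ Real.exp (δ * ((Q : ℝ) + 3)) * Real.exp (-(δ * q)) := by
  have h1 : (1 - δ) ^ (q - 3) ≤ Real.exp (-δ) ^ (q - 3) :=
    pow_le_pow_left₀ (by linarith) (Real.one_sub_le_exp_neg δ) _
  refine h1.trans ?_
  rw [← Real.exp_nat_mul, ← Real.exp_add, Real.exp_le_exp, Nat.cast_sub hq3]
  push_cast
  have : 0 ≤ δ * (Q : ℝ) := by positivity
  nlinarith [this]

omit [MeasurableSpace S] [MeasurableSingletonClass S] [Fintype S] [Nonempty S] [DecidableEq S] in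
/-- `1 ≤ e^{δ(Q+3)} e^{−δ q}` for `q < Q`. [folklore] -/
private theorem one_le_exp_mul_exp {δ : ℝ} (hδ0 : 0 ≤ δ) {q Q : ℕ} (hqQ : q < Q) :
    (1 : ℝ) ≤ Real.exp (δ * ((Q : ℝ) + 3)) * Real.exp (-(δ * q)) := by
  rw [← Real.exp_add]
  refine Real.one_le_exp ?_
  have hQq : (q : ℝ) + 1 ≤ Q := by exact_mod_cast hqQ
  have : 0 ≤ δ * ((Q : ℝ) + 3 - q) := mul_nonneg hδ0 (by linarith)
  nlinarith [this]

/-- **[MOS94] Proposition 2.1** (p0006 L1–6 with (2.3), (2.12)): in two dimensions, if the Gibbs measures of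
a finite-range, translation-invariant, finite-spin interaction satisfy `WM(Λ, C, γ)` for all finite `Λ`,
then there are `C₀, γ₀ > 0` such that for every square `Λ_L`, every site `y ∉ Λ_L`, all boundary conditions
`τ, τ′` that agree off `y` and every event `E` of the spins in `Q_{L,y} = {x ∈ Λ_L : ‖x − y‖_∞ ≥ ⌊√L⌋}`
(`⊇` the printed `{‖x − y‖ ≥ L^{1/2}}`),
`|μ_{Λ_L}^τ(E) − μ_{Λ_L}^{τ′}(E)| ≤ C₀ exp(−γ₀ ⌊⌊√L⌋^{1/2}⌋)` (`⌊⌊√L⌋^{1/2}⌋ ≥ L^{1/4} − 1`; the `L^{1/4}`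
form is `MOS1994_prop2_1_rpow`).  Proof: the surgery coupling of `BoundarySurgeryCoupling` along the
`⌊L^{1/4}⌋ − 1` rings of `SquareRingGeometry`, weak mixing feeding fact (a).
[cite: MartinelliOlivieriSchonmann1994, Proposition 2.1] -/
theorem MOS1994_prop2_1 (U : FRPotential 2 S r) (β : ℝ) {C γ : ℝ} (hC : 0 ≤ C) (hγ : 0 < γ)
    (hWM : ∀ Λ : Finset (Site 2), WeakMixing (U.spec β) r Λ C γ) :
    ∃ C₀ γ₀ : ℝ, 0 < C₀ ∧ 0 < γ₀ ∧ ∀ (L : ℕ) (y : Site 2) (τ τ' : Site 2 → S), y ∉ centeredCube 2 L →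
      (∀ z, z ≠ y → τ z = τ' z) → ∀ E : Set (Site 2 → S), MeasurableSet E →
      DependsOn (· ∈ E) {x | x ∈ centeredCube 2 L ∧ Nat.sqrt L ≤ supDist x y} →
      |(U.spec β (centeredCube 2 L) τ).real E - (U.spec β (centeredCube 2 L) τ').real E| ≤
        C₀ * Real.exp (-(γ₀ * Nat.sqrt (Nat.sqrt L))) := by
  obtain ⟨Cu, hCu0, hCu⟩ := U.exists_uniform_bound
  have hK : 0 ≤ Kconst γ := Kconst_nonneg γ
  -- the finite-energy width `l₀` (term III of fact (a) at most `1/6`)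
  obtain ⟨l₀, hl₀⟩ : ∃ l₀ : ℕ,
      C * Kconst γ * (16 * r * Real.exp (-(γ / 2 * ((l₀ : ℝ) + 1))) * (1 - Real.exp (-(γ / 2)))⁻¹) ≤
        1 / 6 := by
    obtain ⟨N, hN⟩ := exists_nat_pow_mul_exp_le (C * Kconst γ * 16 * r * (1 - Real.exp (-(γ / 2)))⁻¹)
      (half_pos hγ) (by norm_num : (0 : ℝ) < 1 / 6) 0
    refine ⟨N, ?_⟩
    have h := hN (N + 1) (Nat.le_succ N)
    simp only [pow_zero, mul_one, Nat.cast_succ] at h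
    calc C * Kconst γ * (16 * r * Real.exp (-(γ / 2 * ((N : ℝ) + 1))) * (1 - Real.exp (-(γ / 2)))⁻¹)
        = C * Kconst γ * 16 * r * (1 - Real.exp (-(γ / 2)))⁻¹ * Real.exp (-(γ / 2 * ((N : ℝ) + 1))) := by
          ring
      _ ≤ 1 / 6 := h
  -- the contraction factor
  set δ := atomLB β Cu r 2 (Fintype.card S) (8 * r * l₀) / 2 with hδ
  have hε0 := atomLB_pos β Cu r 2 (Fintype.card_pos (α := S)) (8 * r * l₀)
  have hε1 := atomLB_le_one β hCu0 r 2 (Fintype.card_pos (α := S)) (8 * r * l₀)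
  have hδ0 : 0 < δ := by rw [hδ]; linarith
  have hδ1 : δ ≤ 1 := by rw [hδ]; linarith
  -- the thresholds in `q = ⌊⌊√L⌋^{1/2}⌋` (terms I and II of fact (a) at most `1/6` each)
  obtain ⟨N₁, hN₁⟩ := exists_nat_pow_mul_exp_le (C * (2 * r + 3) ^ 4 * Real.exp (γ * r)) hγ
    (by norm_num : (0 : ℝ) < 1 / 6) 8
  obtain ⟨N₂, hN₂⟩ := exists_nat_pow_mul_exp_le (C * Kconst γ * (2 * r + 3) ^ 2 * Real.exp (γ / 2 * r))
    (by positivity : (0 : ℝ) < γ / 4) (by norm_num : (0 : ℝ) < 1 / 6) 4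
  set Q : ℕ := max (max (r + 1) (2 * l₀ + 2 * r + 1)) (max 3 (max N₁ N₂)) with hQ
  refine ⟨Real.exp (δ * ((Q : ℝ) + 3)), δ, Real.exp_pos _, hδ0, ?_⟩
  intro L y τ τ' hy hττ' E hE hdep
  set q := Nat.sqrt (Nat.sqrt L) with hqdef
  have hq2L : q ^ 2 ≤ Nat.sqrt L := by rw [hqdef]; exact Nat.sqrt_le' _
  have hq4L : q ^ 4 ≤ L := by
    calc q ^ 4 = (q ^ 2) ^ 2 := by ring
      _ ≤ Nat.sqrt L ^ 2 := Nat.pow_le_pow_left hq2L 2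
      _ ≤ L := Nat.sqrt_le' _
  clear_value q
  by_cases hqQ : Q ≤ q
  · -- large squares
    have hqr : r + 1 ≤ q := le_trans (by simp [hQ]) hqQ
    have hql : 2 * l₀ + 2 * r + 1 ≤ q := le_trans (by simp [hQ]) hqQ
    have hq3 : 3 ≤ q := le_trans (by simp [hQ]) hqQ
    have hqN₁ : N₁ ≤ q := le_trans (by simp [hQ]) hqQ
    have hqN₂ : N₂ ≤ q := le_trans (by simp [hQ]) hqQ
    by_cases hyr : ∀ j, (y j).natAbs ≤ L + r
    · -- `y ∈ ∂_r^+ Λ_L`: the surgery estimate with `s = q`, `m = (q−1)/2`, `R₀ = r`, `n = q − 1`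
      obtain ⟨p, hp⟩ : ∃ p, q = p + 1 := ⟨q - 1, by omega⟩
      have hn : q - 1 = p := by omega
      have hRL : r + (q - 1) * q + (q - 1) / 2 < L := by
        refine lt_of_lt_of_le ?_ hq4L
        rw [hn, hp]
        exact nat_scales_lt r p (by omega)
      have hfar : {x | x ∈ centeredCube 2 L ∧ Nat.sqrt L ≤ supDist x y} ⊆
          (↑(far L (r + (q - 1) * q) y) : Set (Site 2)) := by
        intro x hx
        refine Finset.mem_coe.2 (mem_far.2 ⟨hx.1, lt_of_lt_of_le ?_ hx.2⟩)
        have h1 : q ^ 2 ≤ Nat.sqrt L := hq2L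
        rw [hp] at h1
        rw [hn, hp]
        have hrp : r ≤ p := by omega
        have e : (p + 1) ^ 2 = p * (p + 1) + p + 1 := by ring
        rw [e] at h1
        omega
      have key := abs_sub_le_pow_square U β hC hγ hCu0 hCu hy hyr hττ' (l₀ := l₀) (m := (q - 1) / 2)
        (s := q) (R₀ := r) (n := q - 1) (by omega) le_rfl (by omega) (by omega) (by omega) hRL
        (fun i _ _ => hWM _) (numeric_smallness hC hγ hl₀ hN₁ hN₂ hqN₁ hqN₂ hqr (by omega) hq3) hE
        (dependsOn_mono hdep hfar)
      refine key.trans ?_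
      rw [show q - 1 - 2 = q - 3 by omega]
      exact pow_le_exp_mul_exp hδ0.le hδ1 q Q hq3
    · -- `y` farther than `r` from the square: no dependence on the spin at `y`
      have hdepΛ : DependsOn (· ∈ E) (↑(centeredCube 2 L) : Set (Site 2)) :=
        dependsOn_mono hdep fun x hx => Finset.mem_coe.2 hx.1
      rw [spec_real_eq_of_far U β hyr hττ' hE hdepΛ, sub_self, abs_zero]
      exact (mul_pos (Real.exp_pos _) (Real.exp_pos _)).le
  · -- small squares: the bound is at least one
    exact (abs_real_sub_real_le_one U β (centeredCube 2 L) τ τ' E).trans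
      (one_le_exp_mul_exp hδ0.le (lt_of_not_ge hqQ))

omit [MeasurableSpace S] [MeasurableSingletonClass S] [Fintype S] [Nonempty S] [DecidableEq S] in
/-- `L < (⌊⌊√L⌋^{1/2}⌋ + 1)⁴`. [folklore] -/
private theorem lt_sqrt_sqrt_succ_pow_four (L : ℕ) : L < (Nat.sqrt (Nat.sqrt L) + 1) ^ 4 := by
  have h1 : Nat.sqrt L + 1 ≤ (Nat.sqrt (Nat.sqrt L) + 1) ^ 2 := Nat.lt_succ_sqrt' _
  calc L < (Nat.sqrt L + 1) ^ 2 := Nat.lt_succ_sqrt' _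
    _ ≤ ((Nat.sqrt (Nat.sqrt L) + 1) ^ 2) ^ 2 := Nat.pow_le_pow_left h1 2
    _ = (Nat.sqrt (Nat.sqrt L) + 1) ^ 4 := by ring

omit [MeasurableSpace S] [MeasurableSingletonClass S] [Fintype S] [Nonempty S] [DecidableEq S] in
/-- `L^{1/4} ≤ q + 1` when `L < (q+1)⁴`. [folklore] -/
private theorem rpow_quarter_le_of_lt {L q : ℕ} (h : L < (q + 1) ^ 4) : (L : ℝ) ^ ((1 : ℝ) / 4) ≤ (q : ℝ) + 1 := by
  have h4 : (L : ℝ) ≤ ((q : ℝ) + 1) ^ (4 : ℕ) := by exact_mod_cast h.le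
  calc (L : ℝ) ^ ((1 : ℝ) / 4) ≤ (((q : ℝ) + 1) ^ (4 : ℕ)) ^ ((1 : ℝ) / 4) :=
        Real.rpow_le_rpow (Nat.cast_nonneg L) h4 (by norm_num)
    _ = (q : ℝ) + 1 := by
        rw [show ((1 : ℝ) / 4) = ((4 : ℕ) : ℝ)⁻¹ by norm_num]
        exact Real.pow_rpow_inv_natCast (by positivity) (by norm_num)

/-- **[MOS94] Proposition 2.1, `L^{1/4}` form** (as printed, (2.3)): under the hypotheses of `MOS1994_prop2_1`,
`|μ_{Λ_L}^τ(E) − μ_{Λ_L}^{τ′}(E)| ≤ C₀ e^{−γ₀ L^{1/4}}` for events `E` of the spins in `Q_{L,y}`.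
[cite: MartinelliOlivieriSchonmann1994, Proposition 2.1] -/
theorem MOS1994_prop2_1_rpow (U : FRPotential 2 S r) (β : ℝ) {C γ : ℝ} (hC : 0 ≤ C) (hγ : 0 < γ)
    (hWM : ∀ Λ : Finset (Site 2), WeakMixing (U.spec β) r Λ C γ) :
    ∃ C₀ γ₀ : ℝ, 0 < C₀ ∧ 0 < γ₀ ∧ ∀ (L : ℕ) (y : Site 2) (τ τ' : Site 2 → S), y ∉ centeredCube 2 L →
      (∀ z, z ≠ y → τ z = τ' z) → ∀ E : Set (Site 2 → S), MeasurableSet E →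
      DependsOn (· ∈ E) {x | x ∈ centeredCube 2 L ∧ Nat.sqrt L ≤ supDist x y} →
      |(U.spec β (centeredCube 2 L) τ).real E - (U.spec β (centeredCube 2 L) τ').real E| ≤
        C₀ * Real.exp (-(γ₀ * (L : ℝ) ^ ((1 : ℝ) / 4))) := by
  obtain ⟨C₀, γ₀, hC₀, hγ₀, h⟩ := MOS1994_prop2_1 U β hC hγ hWM
  refine ⟨C₀ * Real.exp γ₀, γ₀, by positivity, hγ₀, fun L y τ τ' hy hττ' E hE hdep => ?_⟩
  refine (h L y τ τ' hy hττ' E hE hdep).trans ?_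
  have hq := rpow_quarter_le_of_lt (lt_sqrt_sqrt_succ_pow_four L)
  rw [mul_assoc, ← Real.exp_add]
  refine mul_le_mul_of_nonneg_left (Real.exp_le_exp.2 ?_) hC₀.le
  have := mul_le_mul_of_nonneg_left hq hγ₀.le
  linarith

/-- **[MOS94] (2.1)** (p0006): for ARBITRARY boundary conditions `τ, τ′` outside the square `Λ_L`, the
marginals of `μ_{Λ_L}^τ` and `μ_{Λ_L}^{τ′}` on
`Q_{L,τ,τ′} = {x ∈ Λ_L : ‖x − z‖ ≥ L^{1/2} for all z with τ(z) ≠ τ′(z)}` are within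
`C₀ · c · e^{−γ₀ L^{1/4}}` in variation, `c` a boundary-cardinality prefactor linear in `L` («it follows
immediately from Proposition 2.1 and the triangle inequality for the variation distance»).  Stated with the
prefactor the triangle inequality produces, `c = #{z ∈ ∂_r^+Λ_L : τ z ≠ τ′ z} ≤ |∂_r^+Λ_L|`, and with the
disagreement sites restricted to `∂_r^+Λ_L` (sites farther than `r` from `Λ_L` do not influence `μ_{Λ_L}`),
which enlarges `Q`.  [cite: MartinelliOlivieriSchonmann1994, §2 (2.1)] -/
theorem MOS1994_eq2_1 (U : FRPotential 2 S r) (β : ℝ) {C γ : ℝ} (hC : 0 ≤ C) (hγ : 0 < γ)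
    (hWM : ∀ Λ : Finset (Site 2), WeakMixing (U.spec β) r Λ C γ) :
    ∃ C₀ γ₀ : ℝ, 0 < C₀ ∧ 0 < γ₀ ∧ ∀ (L : ℕ) (τ τ' : Site 2 → S) (E : Set (Site 2 → S)), MeasurableSet E →
      DependsOn (· ∈ E) {x | x ∈ centeredCube 2 L ∧
        ∀ z ∈ rOuterBoundary r (centeredCube 2 L), τ z ≠ τ' z → Nat.sqrt L ≤ supDist x z} →
      |(U.spec β (centeredCube 2 L) τ).real E - (U.spec β (centeredCube 2 L) τ').real E| ≤
        C₀ * ((rOuterBoundary r (centeredCube 2 L)).filter (fun z => τ z ≠ τ' z)).card *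
          Real.exp (-(γ₀ * (L : ℝ) ^ ((1 : ℝ) / 4))) := by
  obtain ⟨C₀, γ₀, hC₀, hγ₀, h⟩ := MOS1994_prop2_1_rpow U β hC hγ hWM
  refine ⟨C₀, γ₀, hC₀, hγ₀, fun L τ τ' E hE hdep => ?_⟩
  set e := Real.exp (-(γ₀ * (L : ℝ) ^ ((1 : ℝ) / 4))) with he
  set D := (rOuterBoundary r (centeredCube 2 L)).filter (fun z => τ z ≠ τ' z) with hD
  -- the interpolating boundary conditions: `τ′` on `A`, `τ` elsewhere
  let mix : Finset (Site 2) → Site 2 → S := fun A z => if z ∈ A then τ' z else τ z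
  have hmix_off : ∀ (A : Finset (Site 2)) (a z : Site 2), z ≠ a → mix A z = mix (insert a A) z := by
    intro A a z hz
    simp only [mix, Finset.mem_insert, hz, false_or]
  -- one application of Proposition 2.1 per disagreement site
  have hstep : ∀ A : Finset (Site 2), A ⊆ D →
      |(U.spec β (centeredCube 2 L) τ).real E - (U.spec β (centeredCube 2 L) (mix A)).real E| ≤
        C₀ * A.card * e := by
    intro A
    induction A using Finset.induction_on with
    | empty =>
      intro _
      have h0 : mix ∅ = τ := funext fun z => by simp [mix]
      rw [h0, sub_self, abs_zero, Finset.card_empty, Nat.cast_zero, mul_zero, zero_mul]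
    | insert a A haA ih =>
      intro hAD
      have haD : a ∈ D := hAD (Finset.mem_insert_self a A)
      have hA : A ⊆ D := fun z hz => hAD (Finset.mem_insert_of_mem hz)
      obtain ⟨haB, hane⟩ := Finset.mem_filter.1 haD
      have haΛ : a ∉ centeredCube 2 L := (mem_rOuterBoundary.1 haB).1
      have hdepa : DependsOn (· ∈ E) {x | x ∈ centeredCube 2 L ∧ Nat.sqrt L ≤ supDist x a} :=
        dependsOn_mono hdep fun x hx => ⟨hx.1, hx.2 a haB hane⟩
      have h2 := h L a (mix A) (mix (insert a A)) haΛ (fun z hz => hmix_off A a z hz) E hE hdepa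
      rw [Finset.card_insert_of_notMem haA, Nat.cast_succ]
      calc |(U.spec β (centeredCube 2 L) τ).real E - (U.spec β (centeredCube 2 L) (mix (insert a A))).real E|
          ≤ |(U.spec β (centeredCube 2 L) τ).real E - (U.spec β (centeredCube 2 L) (mix A)).real E| +
            |(U.spec β (centeredCube 2 L) (mix A)).real E -
              (U.spec β (centeredCube 2 L) (mix (insert a A))).real E| := abs_sub_le _ _ _
        _ ≤ C₀ * A.card * e + C₀ * e := add_le_add (ih hA) h2
        _ = C₀ * ((A.card : ℝ) + 1) * e := by ring
  -- `mix D` agrees with `τ′` on `∂_r^+ Λ_L`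
  have hfin : (U.spec β (centeredCube 2 L) (mix D)).real E = (U.spec β (centeredCube 2 L) τ').real E := by
    refine U.spec_real_eq_of_agree β (centeredCube 2 L) hE hdep (fun x hx hxΛ => absurd hx.1 hxΛ)
      fun z hz => ?_
    by_cases hzD : z ∈ D
    · simp [mix, hzD]
    · have hzz : τ z = τ' z := by
        by_contra hne
        exact hzD (Finset.mem_filter.2 ⟨hz, hne⟩)
      simp [mix, hzD, hzz]
  have hmain := hstep D (Finset.Subset.refl D)
  rwa [hfin] at hmain

/-! ### (2.1) on the inner square `Λ_{L−⌊√L⌋}` — the quantity of [MOS94] Theorem 2.1 (2.2) -/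

omit [MeasurableSpace S] [MeasurableSingletonClass S] [Fintype S] [Nonempty S] [DecidableEq S] in
/-- `∂_r^+Λ_L ⊆ Λ_{L+r} ∖ Λ_L`, hence `|∂_r^+Λ_L| ≤ (2(L+r)+1)² − (2L+1)²` (the boundary prefactor of
[MOS94] (2.1), linear in `L`). [cite: MartinelliOlivieriSchonmann1994, §2 (2.1)] -/
theorem card_rOuterBoundary_centeredCube_le (r L : ℕ) :
    (rOuterBoundary r (centeredCube 2 L)).card ≤ (2 * (L + r) + 1) ^ 2 - (2 * L + 1) ^ 2 := by
  have hsub : rOuterBoundary r (centeredCube 2 L) ⊆ centeredCube 2 (L + r) \ centeredCube 2 L := by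
    intro z hz
    obtain ⟨hzΛ, x, hx, hzx⟩ := mem_rOuterBoundary.1 hz
    refine Finset.mem_sdiff.2 ⟨mem_centeredCube.2 fun j => ?_, hzΛ⟩
    have h1 := natAbs_sub_le_supDist z x j
    have h2 := (mem_centeredCube.1 hx) j
    omega
  calc (rOuterBoundary r (centeredCube 2 L)).card ≤ (centeredCube 2 (L + r) \ centeredCube 2 L).card :=
        Finset.card_le_card hsub
    _ = (centeredCube 2 (L + r)).card - (centeredCube 2 L).card :=
        Finset.card_sdiff_of_subset (Glauber.centeredCube_mono (Nat.le_add_right L r))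
    _ = (2 * (L + r) + 1) ^ 2 - (2 * L + 1) ^ 2 := by rw [card_centeredCube, card_centeredCube]

omit [MeasurableSpace S] [MeasurableSingletonClass S] [Fintype S] [Nonempty S] [DecidableEq S] in
/-- A site of the inner square `Λ_{L−⌊√L⌋}` is at `ℓ^∞`-distance `> ⌊√L⌋` from every site outside `Λ_L`.
[cite: MartinelliOlivieriSchonmann1994, §2 (the set `Q_{L,τ,τ′}` ⊇ `Λ_{L−L^{1/2}}`)] -/
theorem sqrt_lt_supDist_of_mem_innerSquare {L : ℕ} {x z : Site 2} (hx : x ∈ centeredCube 2 (L - Nat.sqrt L))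
    (hz : z ∉ centeredCube 2 L) : Nat.sqrt L < supDist x z := by
  rw [mem_centeredCube] at hx hz
  push Not at hz
  obtain ⟨j, hj⟩ := hz
  have h1 := natAbs_sub_le_supDist x z j
  have h2 := hx j
  have h3 : Nat.sqrt L ≤ L := Nat.sqrt_le_self L
  have h4 : ((L - Nat.sqrt L : ℕ) : ℤ) = (L : ℤ) - Nat.sqrt L := by omega
  rw [h4] at h2
  by_cases hzj : -(L : ℤ) ≤ z j
  · have := hj hzj
    omega
  · omega

/-- **[MOS94] (2.1), inner-square form** — the quantity estimated in [MOS94] Theorem 2.1 (2.2) (= the input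
(4.2) of [MO1] Thm 4.1): for ARBITRARY boundary conditions `τ, τ′` and every event `E` of the spins in the
inner square `Λ_{L−⌊√L⌋}`, `|μ_{Λ_L}^τ(E) − μ_{Λ_L}^{τ′}(E)| ≤ C₀ |∂_r^+Λ_L| e^{−γ₀ L^{1/4}}`
(`|∂_r^+Λ_L| ≤ (2(L+r)+1)² − (2L+1)²`, `card_rOuterBoundary_centeredCube_le`).
[cite: MartinelliOlivieriSchonmann1994, §2 (2.1)–(2.2)] -/
theorem MOS1994_eq2_1_innerSquare (U : FRPotential 2 S r) (β : ℝ) {C γ : ℝ} (hC : 0 ≤ C) (hγ : 0 < γ)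
    (hWM : ∀ Λ : Finset (Site 2), WeakMixing (U.spec β) r Λ C γ) :
    ∃ C₀ γ₀ : ℝ, 0 < C₀ ∧ 0 < γ₀ ∧ ∀ (L : ℕ) (τ τ' : Site 2 → S) (E : Set (Site 2 → S)), MeasurableSet E →
      DependsOn (· ∈ E) (↑(centeredCube 2 (L - Nat.sqrt L)) : Set (Site 2)) →
      |(U.spec β (centeredCube 2 L) τ).real E - (U.spec β (centeredCube 2 L) τ').real E| ≤
        C₀ * (rOuterBoundary r (centeredCube 2 L)).card * Real.exp (-(γ₀ * (L : ℝ) ^ ((1 : ℝ) / 4))) := by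
  obtain ⟨C₀, γ₀, hC₀, hγ₀, h⟩ := MOS1994_eq2_1 U β hC hγ hWM
  refine ⟨C₀, γ₀, hC₀, hγ₀, fun L τ τ' E hE hdep => ?_⟩
  have hdep' : DependsOn (· ∈ E) {x | x ∈ centeredCube 2 L ∧
      ∀ z ∈ rOuterBoundary r (centeredCube 2 L), τ z ≠ τ' z → Nat.sqrt L ≤ supDist x z} := by
    refine dependsOn_mono hdep fun x hx => ⟨Glauber.centeredCube_mono (Nat.sub_le L _) (Finset.mem_coe.1 hx),
      fun z hz _ => ?_⟩
    exact (sqrt_lt_supDist_of_mem_innerSquare (Finset.mem_coe.1 hx) (mem_rOuterBoundary.1 hz).1).le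
  refine (h L τ τ' E hE hdep').trans ?_
  have hcard : (((rOuterBoundary r (centeredCube 2 L)).filter fun z => τ z ≠ τ' z).card : ℝ) ≤
      (rOuterBoundary r (centeredCube 2 L)).card := by
    exact_mod_cast Finset.card_filter_le _ _
  have he := (Real.exp_pos (-(γ₀ * (L : ℝ) ^ ((1 : ℝ) / 4)))).le
  gcongr

/-! ### Proposition 2.1 with the scales decoupled from the side of the square

For the block bootstrap of [MOS94] Theorem 1.1 one needs Proposition 2.1 with a reach `q²` that is NOT tied
to `L`: the surgery along the `q − 1` rings of radii `r + iq < q²` works in every square `Λ_L` with `q⁴ ≤ L`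
and gives `(1 − δ₀)^{q−3}` for events of the spins at distance `≥ q²` from `y` («the powers of `L` that appear
in (2.1) and (2.2) are technical and have no physical meaning», [MOS94] p0006 L30–31).  `MOS1994_prop2_1` is
the case `q = ⌊⌊√L⌋^{1/2}⌋`. -/

/-- **[MOS94] Proposition 2.1, free scales**: under weak mixing there are `δ₀ ∈ (0,1]` and `Q` such that for
all `q ≥ Q`, every square `Λ_L` with `q⁴ ≤ L`, every `y ∉ Λ_L`, all `τ, τ′` equal off `y` and every event `E`
of the spins in `{x ∈ Λ_L : ‖x − y‖_∞ ≥ q²}`, `|μ_{Λ_L}^τ(E) − μ_{Λ_L}^{τ′}(E)| ≤ (1 − δ₀)^{q−3}` (the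
surgery of `abs_sub_le_pow_square` with `s = q`, `m = (q−1)/2`, `R₀ = r`, `n = q − 1`).
[cite: MartinelliOlivieriSchonmann1994, Proposition 2.1 (proof, (2.12))] -/
theorem MOS1994_prop2_1_scales (U : FRPotential 2 S r) (β : ℝ) {C γ : ℝ} (hC : 0 ≤ C) (hγ : 0 < γ)
    (hWM : ∀ Λ : Finset (Site 2), WeakMixing (U.spec β) r Λ C γ) :
    ∃ δ₀ : ℝ, 0 < δ₀ ∧ δ₀ ≤ 1 ∧ ∃ Q : ℕ, ∀ q : ℕ, Q ≤ q →
      ∀ (L : ℕ) (y : Site 2) (τ τ' : Site 2 → S), q ^ 4 ≤ L → y ∉ centeredCube 2 L →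
      (∀ z, z ≠ y → τ z = τ' z) → ∀ E : Set (Site 2 → S), MeasurableSet E →
      DependsOn (· ∈ E) {x | x ∈ centeredCube 2 L ∧ q ^ 2 ≤ supDist x y} →
      |(U.spec β (centeredCube 2 L) τ).real E - (U.spec β (centeredCube 2 L) τ').real E| ≤
        (1 - δ₀) ^ (q - 3) := by
  obtain ⟨Cu, hCu0, hCu⟩ := U.exists_uniform_bound
  have hK : 0 ≤ Kconst γ := Kconst_nonneg γ
  -- the finite-energy width `l₀` (term III of fact (a) at most `1/6`)
  obtain ⟨l₀, hl₀⟩ : ∃ l₀ : ℕ,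
      C * Kconst γ * (16 * r * Real.exp (-(γ / 2 * ((l₀ : ℝ) + 1))) * (1 - Real.exp (-(γ / 2)))⁻¹) ≤
        1 / 6 := by
    obtain ⟨N, hN⟩ := exists_nat_pow_mul_exp_le (C * Kconst γ * 16 * r * (1 - Real.exp (-(γ / 2)))⁻¹)
      (half_pos hγ) (by norm_num : (0 : ℝ) < 1 / 6) 0
    refine ⟨N, ?_⟩
    have h := hN (N + 1) (Nat.le_succ N)
    simp only [pow_zero, mul_one, Nat.cast_succ] at h
    calc C * Kconst γ * (16 * r * Real.exp (-(γ / 2 * ((N : ℝ) + 1))) * (1 - Real.exp (-(γ / 2)))⁻¹)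
        = C * Kconst γ * 16 * r * (1 - Real.exp (-(γ / 2)))⁻¹ * Real.exp (-(γ / 2 * ((N : ℝ) + 1))) := by
          ring
      _ ≤ 1 / 6 := h
  -- the contraction factor
  set δ := atomLB β Cu r 2 (Fintype.card S) (8 * r * l₀) / 2 with hδ
  have hε0 := atomLB_pos β Cu r 2 (Fintype.card_pos (α := S)) (8 * r * l₀)
  have hε1 := atomLB_le_one β hCu0 r 2 (Fintype.card_pos (α := S)) (8 * r * l₀)
  have hδ0 : 0 < δ := by rw [hδ]; linarith
  have hδ1 : δ ≤ 1 := by rw [hδ]; linarith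
  -- the thresholds in `q` (terms I and II of fact (a) at most `1/6` each)
  obtain ⟨N₁, hN₁⟩ := exists_nat_pow_mul_exp_le (C * (2 * r + 3) ^ 4 * Real.exp (γ * r)) hγ
    (by norm_num : (0 : ℝ) < 1 / 6) 8
  obtain ⟨N₂, hN₂⟩ := exists_nat_pow_mul_exp_le (C * Kconst γ * (2 * r + 3) ^ 2 * Real.exp (γ / 2 * r))
    (by positivity : (0 : ℝ) < γ / 4) (by norm_num : (0 : ℝ) < 1 / 6) 4
  set Q : ℕ := max (max (r + 1) (2 * l₀ + 2 * r + 1)) (max 3 (max N₁ N₂)) with hQ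
  refine ⟨δ, hδ0, hδ1, Q, ?_⟩
  intro q hqQ L y τ τ' hq4L hy hττ' E hE hdep
  have hqr : r + 1 ≤ q := le_trans (by simp [hQ]) hqQ
  have hql : 2 * l₀ + 2 * r + 1 ≤ q := le_trans (by simp [hQ]) hqQ
  have hq3 : 3 ≤ q := le_trans (by simp [hQ]) hqQ
  have hqN₁ : N₁ ≤ q := le_trans (by simp [hQ]) hqQ
  have hqN₂ : N₂ ≤ q := le_trans (by simp [hQ]) hqQ
  by_cases hyr : ∀ j, (y j).natAbs ≤ L + r
  · -- `y ∈ ∂_r^+ Λ_L`: the surgery estimate with `s = q`, `m = (q−1)/2`, `R₀ = r`, `n = q − 1`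
    obtain ⟨p, hp⟩ : ∃ p, q = p + 1 := ⟨q - 1, by omega⟩
    have hn : q - 1 = p := by omega
    have hRL : r + (q - 1) * q + (q - 1) / 2 < L := by
      refine lt_of_lt_of_le ?_ hq4L
      rw [hn, hp]
      exact nat_scales_lt r p (by omega)
    have hfar : {x | x ∈ centeredCube 2 L ∧ q ^ 2 ≤ supDist x y} ⊆
        (↑(far L (r + (q - 1) * q) y) : Set (Site 2)) := by
      intro x hx
      refine Finset.mem_coe.2 (mem_far.2 ⟨hx.1, lt_of_lt_of_le ?_ hx.2⟩)
      rw [hn, hp]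
      have hrp : r ≤ p := by omega
      have e : (p + 1) ^ 2 = p * (p + 1) + p + 1 := by ring
      rw [e]
      omega
    have key := abs_sub_le_pow_square U β hC hγ hCu0 hCu hy hyr hττ' (l₀ := l₀) (m := (q - 1) / 2)
      (s := q) (R₀ := r) (n := q - 1) (by omega) le_rfl (by omega) (by omega) (by omega) hRL
      (fun i _ _ => hWM _) (numeric_smallness hC hγ hl₀ hN₁ hN₂ hqN₁ hqN₂ hqr (by omega) hq3) hE
      (dependsOn_mono hdep hfar)
    refine key.trans_eq ?_
    rw [show q - 1 - 2 = q - 3 by omega]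
  · -- `y` farther than `r` from the square: no dependence on the spin at `y`
    have hdepΛ : DependsOn (· ∈ E) (↑(centeredCube 2 L) : Set (Site 2)) :=
      dependsOn_mono hdep fun x hx => Finset.mem_coe.2 hx.1
    rw [spec_real_eq_of_far U β hyr hττ' hE hdepΛ, sub_self, abs_zero]
    exact pow_nonneg (by linarith) _

/-- **[MOS94] (2.1), free scales**: for ARBITRARY boundary conditions `τ, τ′`, every square `Λ_L` with
`q⁴ ≤ L` (`q ≥ Q`) and every event `E` of the spins at distance `≥ q²` from every disagreement site of `τ, τ′`
in `∂_r^+Λ_L`, `|μ_{Λ_L}^τ(E) − μ_{Λ_L}^{τ′}(E)| ≤ #{z ∈ ∂_r^+Λ_L : τ z ≠ τ′ z} · (1 − δ₀)^{q−3}` (one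
application of `MOS1994_prop2_1_scales` per disagreement site and the triangle inequality).
[cite: MartinelliOlivieriSchonmann1994, §2 (2.1)] -/
theorem MOS1994_eq2_1_scales (U : FRPotential 2 S r) (β : ℝ) {C γ : ℝ} (hC : 0 ≤ C) (hγ : 0 < γ)
    (hWM : ∀ Λ : Finset (Site 2), WeakMixing (U.spec β) r Λ C γ) :
    ∃ δ₀ : ℝ, 0 < δ₀ ∧ δ₀ ≤ 1 ∧ ∃ Q : ℕ, ∀ q : ℕ, Q ≤ q → ∀ (L : ℕ) (τ τ' : Site 2 → S), q ^ 4 ≤ L →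
      ∀ E : Set (Site 2 → S), MeasurableSet E →
      DependsOn (· ∈ E) {x | x ∈ centeredCube 2 L ∧
        ∀ z ∈ rOuterBoundary r (centeredCube 2 L), τ z ≠ τ' z → q ^ 2 ≤ supDist x z} →
      |(U.spec β (centeredCube 2 L) τ).real E - (U.spec β (centeredCube 2 L) τ').real E| ≤
        ((rOuterBoundary r (centeredCube 2 L)).filter (fun z => τ z ≠ τ' z)).card * (1 - δ₀) ^ (q - 3) := by
  obtain ⟨δ₀, hδ0, hδ1, Q, h⟩ := MOS1994_prop2_1_scales U β hC hγ hWM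
  refine ⟨δ₀, hδ0, hδ1, Q, fun q hq L τ τ' hqL E hE hdep => ?_⟩
  set e := (1 - δ₀) ^ (q - 3) with he
  set D := (rOuterBoundary r (centeredCube 2 L)).filter (fun z => τ z ≠ τ' z) with hD
  -- the interpolating boundary conditions: `τ′` on `A`, `τ` elsewhere
  let mix : Finset (Site 2) → Site 2 → S := fun A z => if z ∈ A then τ' z else τ z
  have hmix_off : ∀ (A : Finset (Site 2)) (a z : Site 2), z ≠ a → mix A z = mix (insert a A) z := by
    intro A a z hz
    simp only [mix, Finset.mem_insert, hz, false_or]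
  -- one application of Proposition 2.1 per disagreement site
  have hstep : ∀ A : Finset (Site 2), A ⊆ D →
      |(U.spec β (centeredCube 2 L) τ).real E - (U.spec β (centeredCube 2 L) (mix A)).real E| ≤
        A.card * e := by
    intro A
    induction A using Finset.induction_on with
    | empty =>
      intro _
      have h0 : mix ∅ = τ := funext fun z => by simp [mix]
      rw [h0, sub_self, abs_zero, Finset.card_empty, Nat.cast_zero, zero_mul]
    | insert a A haA ih =>
      intro hAD
      have haD : a ∈ D := hAD (Finset.mem_insert_self a A)
      have hA : A ⊆ D := fun z hz => hAD (Finset.mem_insert_of_mem hz)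
      obtain ⟨haB, hane⟩ := Finset.mem_filter.1 haD
      have haΛ : a ∉ centeredCube 2 L := (mem_rOuterBoundary.1 haB).1
      have hdepa : DependsOn (· ∈ E) {x | x ∈ centeredCube 2 L ∧ q ^ 2 ≤ supDist x a} :=
        dependsOn_mono hdep fun x hx => ⟨hx.1, hx.2 a haB hane⟩
      have h2 := h q hq L a (mix A) (mix (insert a A)) hqL haΛ (fun z hz => hmix_off A a z hz) E hE hdepa
      rw [Finset.card_insert_of_notMem haA, Nat.cast_succ]
      calc |(U.spec β (centeredCube 2 L) τ).real E - (U.spec β (centeredCube 2 L) (mix (insert a A))).real E|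
          ≤ |(U.spec β (centeredCube 2 L) τ).real E - (U.spec β (centeredCube 2 L) (mix A)).real E| +
            |(U.spec β (centeredCube 2 L) (mix A)).real E -
              (U.spec β (centeredCube 2 L) (mix (insert a A))).real E| := abs_sub_le _ _ _
        _ ≤ A.card * e + e := add_le_add (ih hA) h2
        _ = ((A.card : ℝ) + 1) * e := by ring
  -- `mix D` agrees with `τ′` on `∂_r^+ Λ_L`
  have hfin : (U.spec β (centeredCube 2 L) (mix D)).real E = (U.spec β (centeredCube 2 L) τ').real E := by
    refine U.spec_real_eq_of_agree β (centeredCube 2 L) hE hdep (fun x hx hxΛ => absurd hx.1 hxΛ)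
      fun z hz => ?_
    by_cases hzD : z ∈ D
    · simp [mix, hzD]
    · have hzz : τ z = τ' z := by
        by_contra hne
        exact hzD (Finset.mem_filter.2 ⟨hz, hne⟩)
      simp [mix, hzD, hzz]
  have hmain := hstep D (Finset.Subset.refl D)
  rwa [hfin] at hmain

end WeakMixingSurgery

end Literature.Probability.LatticeModels
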